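import Mathlib
import HarnessLib
import Literature.Computability.AlgebraicComplexity.ArithCircuit
import Literature.Computability.AlgebraicComplexity.SupportSymmetrisation
import Literature.Computability.Complexity.SymPlusProofs

/-!
# The sparse support program (S5 currency of crux `MonotoneRestorationQP`,
stmt-ValiantsHypothesis-15886, stub `stub_monotoneSupportReduction`)

Helper file (`--supports stmt-ValiantsHypothesis-17621`, the rung `MultilinearRestorationQP`; it equally
serves the crux item stmt-ValiantsHypothesis-15886), written by the TTRL-lite deep seat of
variant V20114 (the multilinear rung `MultilinearRestorationQP` in the support-program currency
"S5" of `stub_monotoneSupportReduction`: well-formed straight-line programs over `ℂ` on the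
`n × n` variable matrix with non-nullary gates, a support annotation `K`, product gates taking
only operands supported inside `K i` (`SupportSymm.osupp`), gate `i` invariant under the pointwise
stabiliser of `K i` acting diagonally, and an output gate of empty support).

* `SparseProgram.exists_program` — **the sparse monomial program** (sibling variant V20111):
  every polynomial `p` over `ℂ` invariant under simultaneous row/column permutations is computed
  by the program with one product gate per monomial `m` (operands: the coefficient and the
  variables of `m` with multiplicity; support `rows(m) ∪ cols(m)`, `≤ 2 deg p` indices) and one
  final sum gate of empty support; size `#supp p + 1`, fan-in `≤ max (deg p + 1) (#supp p + 1)`.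

Consumed by `Theorems/MonotoneRestorationMonotoneRestorationQPSupportReductionCore.lean` (the
polylog-degree slice of the rung in S5 currency and the reduction of V20114 to its core).
Source: Bürgisser 2000 Def. 2.1 (the circuit model); folklore (the list lemma
`BT.Setup.length_flatMap_replicate` is reused from `Literature/Computability/Complexity`). No named
facts, no defs.
-/

set_option linter.dupNamespace false

namespace Summit.ValiantsHypothesis.ValiantsHypothesis.Theorems

open Literature.Computability.AlgebraicComplexity

namespace SparseProgram

open MvPolynomial

variable {n : ℕ}

/-- Product of the evaluated "variable with multiplicity" operand list. [folklore] -/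
theorem prod_map_flatMap_replicate {α β R : Type*} [CommMonoid R] (l : List α) (m : α → ℕ)
    (v : α → β) (x : β → R) :
    ((l.flatMap fun a => List.replicate (m a) (v a)).map x).prod =
      (l.map fun a => x (v a) ^ m a).prod := by
  induction l with
  | nil => simp
  | cons a l ih =>
    simp [List.flatMap_cons, List.map_append, List.prod_append, List.map_replicate,
      List.prod_replicate, ih]

/-- The support of a monomial has at most `degree` elements. [folklore] -/
theorem card_support_le_degree {α : Type*} (m : α →₀ ℕ) :
    m.support.card ≤ m.sum fun _ e => e := by
  rw [Finsupp.sum, Finset.card_eq_sum_ones]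
  exact Finset.sum_le_sum fun a ha => Nat.one_le_iff_ne_zero.mpr (Finsupp.mem_support_iff.mp ha)

/-- Value list of a list of gates that ignore the earlier values. [folklore] -/
theorem gateValues_map_eq {k σ α : Type*} [CommSemiring k] (L : List α)
    (gate : α → ArithCircuit.Gate k σ) (w : α → MvPolynomial σ k)
    (h : ∀ a vals, (gate a).eval vals = w a) :
    ArithCircuit.gateValues (L.map gate) = L.map w := by
  induction L using List.reverseRecOn with
  | nil => rfl
  | append_singleton L a ih =>
    rw [List.map_append, List.map_singleton, ArithCircuit.gateValues_append_singleton, ih,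
      List.map_append, List.map_singleton, h]

/-- Summing a list through its indices. [folklore] -/
theorem sum_map_range_getD {R : Type*} [AddMonoid R] (l : List R) :
    ((List.range l.length).map fun t => l.getD t 0).sum = l.sum := by
  induction l using List.reverseRecOn with
  | nil => simp
  | append_singleton l a ih =>
    rw [List.length_append, List.length_singleton, List.range_succ, List.map_append,
      List.map_singleton, List.sum_append, List.sum_singleton, List.sum_append, List.sum_singleton]
    congr 1
    · rw [← ih]
      refine congrArg List.sum (List.map_congr_left fun t ht => ?_)
      rw [List.mem_range] at ht
      rw [List.getD_eq_getElem?_getD, List.getD_eq_getElem?_getD, List.getElem?_append_left ht]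
    · rw [List.getD_eq_getElem?_getD, List.getElem?_append_right le_rfl, Nat.sub_self]
      simp

/-- **The sparse support program.** Every polynomial `p` over `ℂ` on the `n × n` matrix that is
invariant under simultaneous row/column permutations is computed by the program with one
product gate per monomial `m` (operands: the coefficient and the variables of `m` with
multiplicity; support `rows(m) ∪ cols(m)`, of size `≤ 2 deg p`) followed by one sum gate of
empty support adding them up (fan-in `#supp p + 1`); size `#supp p + 1`. [folklore] -/
theorem exists_program (p : MvPolynomial (Fin n × Fin n) ℂ)
    (hinv : ∀ σ : Equiv.Perm (Fin n),
      rename (fun pq : Fin n × Fin n => (σ pq.1, σ pq.2)) p = p) :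
    ∃ (P : ArithCircuit ℂ (Fin n × Fin n)) (K : ℕ → Finset (Fin n)),
      (∀ g ∈ P.gates, g.args ≠ []) ∧
      (∀ g ∈ P.gates, g.fanIn ≤ max (p.totalDegree + 1) (p.support.card + 1)) ∧
      P.WellFormed ∧
      (∀ i, (K i).card ≤ 2 * p.totalDegree) ∧
      (∀ (i : ℕ) (us : List (ArithCircuit.Operand ℂ (Fin n × Fin n))),
        P.gates[i]? = some (.prod us) → ∀ u ∈ us, SupportSymm.osupp K u ⊆ K i) ∧
      (∀ (i : ℕ) (σ : Equiv.Perm (Fin n)), i < P.size → (∀ x ∈ K i, σ x = x) →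
        rename (fun pq : Fin n × Fin n => (σ pq.1, σ pq.2))
          ((ArithCircuit.gateValues P.gates).getD i 0) =
          (ArithCircuit.gateValues P.gates).getD i 0) ∧
      (∃ j, P.output = .gate j ∧ j < P.size ∧ K j = ∅) ∧
      P.size = p.support.card + 1 ∧ P.eval = p := by
  classical
  set L := p.support.toList with hL
  have hlen : L.length = p.support.card := by rw [hL, Finset.length_toList]
  have hmemL : ∀ m, m ∈ L ↔ m ∈ p.support := fun m => by rw [hL, Finset.mem_toList]
  -- the value, operands, gate and support of a monomial
  let val : ((Fin n × Fin n) →₀ ℕ) → MvPolynomial (Fin n × Fin n) ℂ := fun m =>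
    C (p.coeff m) * (m.support.toList.map fun a => (X a : MvPolynomial _ ℂ) ^ m a).prod
  let ops : ((Fin n × Fin n) →₀ ℕ) → List (ArithCircuit.Operand ℂ (Fin n × Fin n)) := fun m =>
    .const (p.coeff m) :: m.support.toList.flatMap fun a => List.replicate (m a) (.var a)
  let gate : ((Fin n × Fin n) →₀ ℕ) → ArithCircuit.Gate ℂ (Fin n × Fin n) := fun m => .prod (ops m)
  let Kof : ((Fin n × Fin n) →₀ ℕ) → Finset (Fin n) := fun m =>
    m.support.image Prod.fst ∪ m.support.image Prod.snd
  -- the output sum gate, the program and the support annotation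
  let sg : ArithCircuit.Gate ℂ (Fin n × Fin n) :=
    .sum (((0 : ℂ), .const 0) :: (List.range L.length).map fun t => ((1 : ℂ), .gate t))
  let P : ArithCircuit ℂ (Fin n × Fin n) := ⟨L.map gate ++ [sg], .gate L.length⟩
  let K : ℕ → Finset (Fin n) := fun i => (L[i]?.map Kof).getD ∅
  -- basic facts
  have hval_gate : ∀ m vals, (gate m).eval vals = val m := by
    intro m vals
    show ((ops m).map fun u => u.eval vals).prod = val m
    simp only [ops, List.map_cons, List.prod_cons, ArithCircuit.Operand.eval]
    rw [prod_map_flatMap_replicate]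
  have hval_mon : ∀ m, val m = monomial m (p.coeff m) := by
    intro m
    simp only [val]
    rw [Finset.prod_map_toList, prod_X_pow_eq_monomial, C_mul_monomial, mul_one]
  have hvals : ArithCircuit.gateValues (L.map gate) = L.map val :=
    gateValues_map_eq L gate val hval_gate
  have hsumL : (L.map val).sum = p := by
    rw [hL, Finset.sum_map_toList]
    simp only [hval_mon]
    exact support_sum_monomial_coeff p
  have hsg : sg.eval (L.map val) = p := by
    show ((((0 : ℂ), ArithCircuit.Operand.const 0) ::
      (List.range L.length).map fun t => ((1 : ℂ), ArithCircuit.Operand.gate t)).map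
        fun a => a.1 • a.2.eval (L.map val)).sum = p
    rw [List.map_cons, List.sum_cons, zero_smul, zero_add, List.map_map]
    have : ((fun a : ℂ × ArithCircuit.Operand ℂ (Fin n × Fin n) => a.1 • a.2.eval (L.map val)) ∘
        fun t => ((1 : ℂ), ArithCircuit.Operand.gate t)) = fun t => (L.map val).getD t 0 := by
      funext t
      simp
    rw [this, ← List.length_map (f := val), sum_map_range_getD, hsumL]
  have hgv : ArithCircuit.gateValues P.gates = L.map val ++ [p] := by
    show ArithCircuit.gateValues (L.map gate ++ [sg]) = _
    rw [ArithCircuit.gateValues_append_singleton, hvals, hsg]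
  have hsize : P.size = L.length + 1 := by
    show (L.map gate ++ [sg]).length = _
    rw [List.length_append, List.length_map, List.length_singleton]
  -- gate lookup
  have hget1 : ∀ i, i < L.length → ∃ m, L[i]? = some m ∧ P.gates[i]? = some (gate m) := by
    intro i hi
    refine ⟨L[i], List.getElem?_eq_getElem hi, ?_⟩
    show (L.map gate ++ [sg])[i]? = _
    rw [List.getElem?_append_left (by rw [List.length_map]; exact hi), List.getElem?_map,
      List.getElem?_eq_getElem hi]
    rfl
  have hget2 : P.gates[L.length]? = some sg := by
    show (L.map gate ++ [sg])[L.length]? = _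
    rw [List.getElem?_append_right (by rw [List.length_map]), List.length_map, Nat.sub_self]
    rfl
  have hget3 : ∀ i, L.length < i → P.gates[i]? = none := by
    intro i hi
    apply List.getElem?_eq_none_iff.mpr
    show P.size ≤ i
    rw [hsize]
    exact hi
  have hK1 : ∀ i m, L[i]? = some m → K i = Kof m := by
    intro i m hm
    simp [K, hm]
  have hK2 : ∀ i, L.length ≤ i → K i = ∅ := by
    intro i hi
    simp [K, List.getElem?_eq_none_iff.mpr hi]
  have hmem_gates : ∀ g ∈ P.gates, (∃ m ∈ L, g = gate m) ∨ g = sg := by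
    intro g hg
    change g ∈ L.map gate ++ [sg] at hg
    rw [List.mem_append, List.mem_map, List.mem_singleton] at hg
    rcases hg with ⟨m, hm, rfl⟩ | rfl
    · exact Or.inl ⟨m, hm, rfl⟩
    · exact Or.inr rfl
  have hops_mem : ∀ m u, u ∈ ops m → u = .const (p.coeff m) ∨ ∃ a ∈ m.support, u = .var a := by
    intro m u hu
    simp only [ops, List.mem_cons, List.mem_flatMap, Finset.mem_toList, List.mem_replicate] at hu
    rcases hu with rfl | ⟨a, ha, -, rfl⟩
    · exact Or.inl rfl
    · exact Or.inr ⟨a, ha, rfl⟩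
  have hKof_mem : ∀ m, ∀ a ∈ m.support, a.1 ∈ Kof m ∧ a.2 ∈ Kof m := by
    intro m a ha
    simp only [Kof, Finset.mem_union, Finset.mem_image]
    exact ⟨Or.inl ⟨a, ha, rfl⟩, Or.inr ⟨a, ha, rfl⟩⟩
  have hdeg : ∀ m ∈ L, (m.sum fun _ e => e) ≤ p.totalDegree := by
    intro m hm
    exact le_totalDegree ((hmemL m).1 hm)
  refine ⟨P, K, ?_, ?_, ?_, ?_, ?_, ?_, ⟨L.length, rfl, ?_, hK2 _ le_rfl⟩, ?_, ?_⟩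
  · -- nonempty argument lists
    intro g hg
    rcases hmem_gates g hg with ⟨m, -, rfl⟩ | rfl
    · simp [gate, ops, ArithCircuit.Gate.args]
    · simp [sg, ArithCircuit.Gate.args]
  · -- fan-in
    intro g hg
    rcases hmem_gates g hg with ⟨m, hm, rfl⟩ | rfl
    · have h : (gate m).fanIn = (m.sum fun _ e => e) + 1 := by
        show (ops m).length = _
        simp only [ops, List.length_cons]
        rw [Literature.Computability.Complexity.BT.Setup.length_flatMap_replicate, Finset.sum_map_toList]
        rfl
      rw [h]
      exact le_max_of_le_left (Nat.succ_le_succ (hdeg m hm))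
    · have h : sg.fanIn = L.length + 1 := by
        simp [sg, ArithCircuit.Gate.fanIn, ArithCircuit.Gate.args]
      rw [h, hlen]
      exact le_max_right _ _
  · -- well-formedness
    constructor
    · intro i g hg u hu
      rcases lt_trichotomy i L.length with hi | rfl | hi
      · obtain ⟨m, -, hPm⟩ := hget1 i hi
        rw [hPm, Option.some.injEq] at hg
        subst hg
        rcases hops_mem m u hu with rfl | ⟨a, -, rfl⟩
        · trivial
        · trivial
      · rw [hget2, Option.some.injEq] at hg
        subst hg
        simp only [sg, ArithCircuit.Gate.args, List.map_cons, List.map_map, List.mem_cons,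
          List.mem_map, Function.comp_apply, List.mem_range] at hu
        rcases hu with rfl | ⟨t, ht, rfl⟩
        · trivial
        · exact ht
      · rw [hget3 i hi] at hg
        exact absurd hg (by simp)
    · show L.length < P.size
      rw [hsize]
      exact Nat.lt_succ_self _
  · -- support widths
    intro i
    cases hLi : L[i]? with
    | none => simp [K, hLi]
    | some m =>
      rw [hK1 i m hLi]
      have hm : m ∈ L := List.mem_of_getElem? hLi
      calc (Kof m).card ≤ (m.support.image Prod.fst).card + (m.support.image Prod.snd).card :=
            Finset.card_union_le _ _
        _ ≤ m.support.card + m.support.card :=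
            Nat.add_le_add Finset.card_image_le Finset.card_image_le
        _ ≤ (m.sum fun _ e => e) + (m.sum fun _ e => e) :=
            Nat.add_le_add (card_support_le_degree m) (card_support_le_degree m)
        _ ≤ p.totalDegree + p.totalDegree := Nat.add_le_add (hdeg m hm) (hdeg m hm)
        _ = 2 * p.totalDegree := by ring
  · -- hereditary supports at product gates
    intro i us hg u hu
    rcases lt_trichotomy i L.length with hi | rfl | hi
    · obtain ⟨m, hLm, hPm⟩ := hget1 i hi
      rw [hPm, Option.some.injEq] at hg
      have hus : us = ops m := by
        simp only [gate] at hg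
        exact (ArithCircuit.Gate.prod.inj hg).symm
      subst hus
      rw [hK1 i m hLm]
      rcases hops_mem m u hu with rfl | ⟨a, ha, rfl⟩
      · simp [SupportSymm.osupp]
      · obtain ⟨h1, h2⟩ := hKof_mem m a ha
        simp only [SupportSymm.osupp, Finset.insert_subset_iff, Finset.singleton_subset_iff]
        exact ⟨h1, h2⟩
    · rw [hget2, Option.some.injEq] at hg
      simp [sg] at hg
    · rw [hget3 i hi] at hg
      exact absurd hg (by simp)
  · -- invariance of every gate under the pointwise stabiliser of its support
    intro i σ hi hfix
    rw [hsize] at hi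
    rw [hgv]
    rcases Nat.lt_succ_iff_lt_or_eq.1 hi with hi | rfl
    · obtain ⟨m, hLm, -⟩ := hget1 i hi
      rw [hK1 i m hLm] at hfix
      have hget : (L.map val ++ [p]).getD i 0 = val m := by
        rw [List.getD_eq_getElem?_getD, List.getElem?_append_left (by simpa using hi),
          List.getElem?_map, hLm]
        rfl
      rw [hget]
      simp only [val, map_mul, rename_C, map_list_prod, List.map_map]
      congr 1
      refine congrArg List.prod (List.map_congr_left fun a ha => ?_)
      rw [Finset.mem_toList] at ha
      obtain ⟨h1, h2⟩ := hKof_mem m a ha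
      simp only [Function.comp_apply, map_pow, rename_X]
      rw [hfix _ h1, hfix _ h2]
    · have hget : (L.map val ++ [p]).getD L.length 0 = p := by
        rw [List.getD_eq_getElem?_getD, List.getElem?_append_right (by simp), List.length_map,
          Nat.sub_self]
        rfl
      rw [hget]
      exact hinv σ
  · -- the output gate is a gate
    rw [hsize]
    exact Nat.lt_succ_self _
  · -- size
    rw [hsize, hlen]
  · -- the computed polynomial
    show (ArithCircuit.Operand.gate L.length : ArithCircuit.Operand ℂ (Fin n × Fin n)).eval
        (ArithCircuit.gateValues P.gates) = p
    rw [ArithCircuit.Operand.eval_gate, hgv, List.getD_eq_getElem?_getD,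
      List.getElem?_append_right (by simp), List.length_map, Nat.sub_self]
    rfl

end SparseProgram

end Summit.ValiantsHypothesis.ValiantsHypothesis.Theorems
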